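import Summits.QuantumFields.QCD.Theses.SpectralDefectExtinction
import Summits.QuantumFields.QCD.Theorems.ExtinctionBuildsQCD.Negative.ExtinctIntegrable
import Literature.MathematicalPhysics.QuantumLattice.WilsonHopFlatSections
import Literature.Analysis.InnerProduct.NumericalRadiusPower

/-!
# Stub `stub_twoLineAssembly` (S2e) of line `corner-decorrelation-deep-hole` — auxiliary file 1:
# the pathwise column bound
(crux `Summit.QuantumFields.QCD.Theses.SpectralDefectExtinction.WindowExtinction`, item stmt-QuantumFields-18063)

Deterministic linear algebra behind the assembly of the two-line decay.  Write
`K_U = 4·1 − D_W(U,0,1) = Σ_μ W_μ` (`cornerAsm_four_smul_one_sub_wilsonDirac`) and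
`‖K_Uⁿ‖_F² = Σ_q ‖K_Uⁿ e_q‖²` (`cornerAsm_frob_eq_sum_col`).  For a column index `q = (x,a,s)`:

* the sites reachable in `j` steps, `A_j = x + proj(box j)`, form a neighbour-closed chain
  (`cornerAsm_chain`), so `K_Uⁿ e_q = (P K_U P)ⁿ e_q` with `P` the projection onto `A_n`
  (landed `pow_mulVec_eq_compressed_of_local`);
* always `‖K_Uⁿ e_q‖² ≤ 16ⁿ` (`‖W_μ‖ ≤ 1`; `cornerAsm_col_le_sixteen_pow`);
* if NO fermion field supported in `A_n` is `θ`-flat (`|⟨ψ, K_U ψ⟩| ≥ 4(1−θ)‖ψ‖²`), the compressed operator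
  has numerical radius `≤ 4(1−θ)` and the Berger–Pearcy power inequality (landed
  `matrix_norm_pow_mulVec_le_two_mul_numericalRadius_pow`) gives `‖K_Uⁿ e_q‖² ≤ 4 (4(1−θ))^{2n}`
  (`cornerAsm_col_le_of_not_flat`).
-/

noncomputable section

namespace Summit.QuantumFields.QCD.Cruxes.WindowExtinction.CornerDecorrelationDeepHole

open scoped BigOperators Topology Classical Matrix InnerProductSpace
open Filter MeasureTheory
open Literature.MathematicalPhysics.QuantumLattice Literature.MathematicalPhysics.QuantumFieldTheory
  Literature.Probability.LatticeModels

/-! ## The hopping operator and the Frobenius norm as a sum of columns -/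

/-- `4·1 − D_W(U,0,1) = Σ_μ W_μ` (the Wilson hopping operator `K_U`). -/
theorem cornerAsm_four_smul_one_sub_wilsonDirac (L : ℕ) [NeZero L] (U : GaugeConfig 4 L SU3) :
    (4 : ℂ) • (1 : Matrix (QuarkIdx L) (QuarkIdx L) ℂ) - wilsonDirac (fundamentalRep (Fin 3)) U 0 1 =
      ∑ μ, wilsonHop (fundamentalRep (Fin 3)) U μ := by
  rw [wilsonDirac_eq_sub_sum_wilsonHop (fundamentalRep (Fin 3)) fundamentalRep_mem_unitaryGroup U 0]
  have h : ((0 + 4 : ℝ) : ℂ) = 4 := by push_cast; ring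
  rw [h, sub_sub_cancel]

/-- The squared Frobenius norm is the sum of the squared norms of the columns `M e_j`. -/
theorem cornerAsm_frob_eq_sum_col {ι : Type*} [Fintype ι] [DecidableEq ι] (M : Matrix ι ι ℂ) :
    ∑ i, ∑ j, ‖M i j‖ ^ 2 = ∑ j, ∑ i, ‖(M *ᵥ Pi.single j 1) i‖ ^ 2 := by
  rw [Finset.sum_comm]
  refine Finset.sum_congr rfl fun j _ => Finset.sum_congr rfl fun i _ => ?_
  rw [Matrix.mulVec_single_one]
  rfl

/-! ## The chain of reachable site sets -/

/-- **The balls `A_j = x + proj(box j)` form a neighbour-closed chain** around the column index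
`q = (x,a,s)`: `A_j ⊆ A_n` for `j ≤ n`, a site outside `A_{j+1}` has no neighbour in `A_j`, and the column
vector `e_q` is supported in `A_0 = {x}`. -/
theorem cornerAsm_chain (L : ℕ) (q : QuarkIdx L) (n : ℕ) :
    (∀ j, j ≤ n → {y : TorusSite 4 L | ∃ v ∈ box 4 j, y = q.1 + Torus.proj L v} ⊆
      {y : TorusSite 4 L | ∃ v ∈ box 4 n, y = q.1 + Torus.proj L v}) ∧
    (∀ j, j < n → ∀ y, y ∉ {y : TorusSite 4 L | ∃ v ∈ box 4 (j + 1), y = q.1 + Torus.proj L v} →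
      ∀ μ, Site.shift y μ ∉ {y : TorusSite 4 L | ∃ v ∈ box 4 j, y = q.1 + Torus.proj L v} ∧
        y - Pi.single μ 1 ∉ {y : TorusSite 4 L | ∃ v ∈ box 4 j, y = q.1 + Torus.proj L v}) ∧
    (∀ p : QuarkIdx L, p.1 ∉ {y : TorusSite 4 L | ∃ v ∈ box 4 0, y = q.1 + Torus.proj L v} →
      (Pi.single q (1 : ℂ) : QuarkIdx L → ℂ) p = 0) := by
  -- the torus projection is additive and fixes the unit vectors
  have hadd : ∀ v w : Fin 4 → ℤ, Torus.proj L (v + w) = Torus.proj L v + Torus.proj L w := fun v w => by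
    ext i; simp [Torus.proj, Int.cast_add]
  have hzero : Torus.proj L (0 : Fin 4 → ℤ) = 0 := by ext i; simp [Torus.proj]
  have hsingle : ∀ μ : Fin 4, Torus.proj L (Pi.single μ 1) = Pi.single μ 1 := fun μ => by
    ext i
    simp only [Torus.proj, Pi.single_apply]
    split_ifs <;> simp
  have hneg : ∀ μ : Fin 4, Torus.proj L (-Pi.single μ 1 : Fin 4 → ℤ) = -Pi.single μ 1 := fun μ => by
    have h0 := hadd (Pi.single μ 1) (-Pi.single μ 1)
    rw [add_neg_cancel, hzero, hsingle] at h0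
    exact (neg_eq_of_add_eq_zero_right h0.symm).symm
  refine ⟨fun j hj y hy => ?_, fun j _ y hy μ => ⟨fun h => hy ?_, fun h => hy ?_⟩, fun p hp => ?_⟩
  · obtain ⟨v, hv, rfl⟩ := hy
    exact ⟨v, box_mono 4 hj hv, rfl⟩
  · obtain ⟨v, hv, h⟩ := h
    refine ⟨v - Pi.single μ 1, ?_, ?_⟩
    · rw [mem_box] at hv ⊢
      intro i
      have := hv i
      simp only [Pi.sub_apply, Pi.single_apply]
      push_cast
      split_ifs <;> constructor <;> omega
    · rw [sub_eq_add_neg, hadd, ← add_assoc, ← h, hneg]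
      exact (add_neg_cancel_right y (Pi.single μ 1)).symm
  · obtain ⟨v, hv, h⟩ := h
    refine ⟨v + Pi.single μ 1, ?_, ?_⟩
    · rw [mem_box] at hv ⊢
      intro i
      have := hv i
      simp only [Pi.add_apply, Pi.single_apply]
      push_cast
      split_ifs <;> constructor <;> omega
    · rw [hadd, hsingle, ← add_assoc, ← h, sub_add_cancel]
  · have hne : p ≠ q := by
      rintro rfl
      exact hp ⟨0, by simp [mem_box], by rw [hzero, add_zero]⟩
    simp [hne]

/-- **Compression of a column to the ball it can reach**: `K_Uⁿ e_q = (P K_U P)ⁿ e_q` with `P` the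
coordinate projection onto the sites of `A_n = x + proj(box n)`. -/
theorem cornerAsm_pow_mulVec_single_eq (L : ℕ) [NeZero L] (U : GaugeConfig 4 L SU3) (n : ℕ)
    (q : QuarkIdx L) :
    (∑ μ, wilsonHop (fundamentalRep (Fin 3)) U μ) ^ n *ᵥ Pi.single q 1 =
      (Matrix.diagonal (fun p : QuarkIdx L =>
          if p.1 ∈ {y : TorusSite 4 L | ∃ v ∈ box 4 n, y = q.1 + Torus.proj L v} then (1 : ℂ) else 0) *
        (∑ μ, wilsonHop (fundamentalRep (Fin 3)) U μ) *
        Matrix.diagonal (fun p : QuarkIdx L =>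
          if p.1 ∈ {y : TorusSite 4 L | ∃ v ∈ box 4 n, y = q.1 + Torus.proj L v} then (1 : ℂ) else 0)) ^ n *ᵥ
      Pi.single q 1 := by
  obtain ⟨hmono, hstep, hsupp⟩ := cornerAsm_chain L q n
  exact (pow_mulVec_eq_compressed_of_local (∑ μ, wilsonHop (fundamentalRep (Fin 3)) U μ)
    (fun φ _ _ hφ hx a s => wilsonHopSum_mulVec_apply_eq_zero _ U φ hφ hx a s) (Pi.single q 1) n
    (fun j => {y : TorusSite 4 L | ∃ v ∈ box 4 j, y = q.1 + Torus.proj L v}) hmono hstep hsupp n le_rfl).2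

/-! ## The two column bounds -/

section ColumnBounds

open scoped Matrix.Norms.L2Operator

/-- **Trivial column bound**: `‖K_Uⁿ e_q‖² ≤ 16ⁿ` (`‖K_U‖ ≤ Σ_μ ‖W_μ‖ ≤ 4`). -/
theorem cornerAsm_col_le_sixteen_pow (L : ℕ) [NeZero L] (U : GaugeConfig 4 L SU3) {n : ℕ} (hn : 1 ≤ n)
    (q : QuarkIdx L) :
    ∑ p, ‖((∑ μ, wilsonHop (fundamentalRep (Fin 3)) U μ) ^ n *ᵥ Pi.single q 1) p‖ ^ 2 ≤ 16 ^ n := by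
  set K : Matrix (QuarkIdx L) (QuarkIdx L) ℂ := ∑ μ, wilsonHop (fundamentalRep (Fin 3)) U μ with hK
  have hK4 : ‖K‖ ≤ 4 :=
    calc ‖K‖ ≤ ∑ μ : Fin 4, ‖wilsonHop (fundamentalRep (Fin 3)) U μ‖ := norm_sum_le _ _
      _ ≤ ∑ _μ : Fin 4, (1 : ℝ) := Finset.sum_le_sum fun μ _ =>
          l2_opNorm_wilsonHop_le (fundamentalRep (Fin 3)) fundamentalRep_mem_unitaryGroup U μ
      _ = 4 := by simp
  have hKn : ‖K ^ n‖ ≤ 4 ^ n := (norm_pow_le' K (by omega)).trans (pow_le_pow_left₀ (norm_nonneg _) hK4 n)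
  have h1 : ∑ p, ‖(Pi.single q (1 : ℂ) : QuarkIdx L → ℂ) p‖ ^ 2 = 1 := by
    rw [Finset.sum_eq_single q (fun p _ hp => by simp [hp]) (fun h => absurd (Finset.mem_univ q) h)]
    simp
  calc ∑ p, ‖(K ^ n *ᵥ Pi.single q 1) p‖ ^ 2 ≤ ‖K ^ n‖ ^ 2 * ∑ p, ‖(Pi.single q (1 : ℂ) : QuarkIdx L → ℂ) p‖ ^ 2 :=
        sum_norm_sq_mulVec_le _ _
    _ = ‖K ^ n‖ ^ 2 := by rw [h1, mul_one]
    _ ≤ (4 ^ n) ^ 2 := pow_le_pow_left₀ (norm_nonneg _) hKn 2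
    _ = 16 ^ n := by rw [← pow_mul, mul_comm, pow_mul]; norm_num

/-- **Column bound off the flat event (Berger–Pearcy)**: if every non-zero fermion field supported in the
ball `A_n = x + proj(box n)` has `|⟨ψ, K_U ψ⟩| < 4(1−θ)‖ψ‖²`, then `‖K_Uⁿ e_q‖² ≤ 4 (4(1−θ))^{2n}`. -/
theorem cornerAsm_col_le_of_not_flat (L : ℕ) [NeZero L] (U : GaugeConfig 4 L SU3) {θ : ℝ} (hθ : θ ≤ 1)
    (n : ℕ) (q : QuarkIdx L)
    (hnf : ∀ ψ : QuarkIdx L → ℂ, (∀ p, ψ p ≠ 0 → ∃ v ∈ box 4 n, p.1 = q.1 + Torus.proj L v) →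
      0 < ∑ p, ‖ψ p‖ ^ 2 →
      ‖∑ p, star (ψ p) * ((∑ μ, wilsonHop (fundamentalRep (Fin 3)) U μ) *ᵥ ψ) p‖ <
        4 * (1 - θ) * ∑ p, ‖ψ p‖ ^ 2) :
    ∑ p, ‖((∑ μ, wilsonHop (fundamentalRep (Fin 3)) U μ) ^ n *ᵥ Pi.single q 1) p‖ ^ 2 ≤
      4 * (4 * (1 - θ)) ^ (2 * n) := by
  set K : Matrix (QuarkIdx L) (QuarkIdx L) ℂ := ∑ μ, wilsonHop (fundamentalRep (Fin 3)) U μ with hK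
  set A : Set (TorusSite 4 L) := {y : TorusSite 4 L | ∃ v ∈ box 4 n, y = q.1 + Torus.proj L v} with hA
  set P : Matrix (QuarkIdx L) (QuarkIdx L) ℂ :=
    Matrix.diagonal (fun p : QuarkIdx L => if p.1 ∈ A then (1 : ℂ) else 0) with hP
  have heq : K ^ n *ᵥ Pi.single q 1 = (P * K * P) ^ n *ᵥ Pi.single q 1 :=
    cornerAsm_pow_mulVec_single_eq L U n q
  set X : Matrix (QuarkIdx L) (QuarkIdx L) ℂ := P * K * P with hX
  have hc : 0 ≤ 4 * (1 - θ) := by linarith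
  -- numerical radius of the compressed operator
  have hnr : ∀ v : EuclideanSpace ℂ (QuarkIdx L),
      ‖⟪v, Matrix.toEuclideanLin X v⟫_ℂ‖ ≤ 4 * (1 - θ) * ‖v‖ ^ 2 := by
    intro v
    set φ : QuarkIdx L → ℂ := (v : QuarkIdx L → ℂ) with hφ
    set ψ : QuarkIdx L → ℂ := fun p => (if p.1 ∈ A then (1 : ℂ) else 0) * φ p with hψ
    have hPφ : ∀ w : QuarkIdx L → ℂ, P *ᵥ w = fun p => (if p.1 ∈ A then (1 : ℂ) else 0) * w p :=
      fun w => by ext p; rw [hP, Matrix.mulVec_diagonal]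
    have hinner : ⟪v, Matrix.toEuclideanLin X v⟫_ℂ = ∑ p, star (ψ p) * (K *ᵥ ψ) p := by
      show (X *ᵥ φ) ⬝ᵥ star φ = _
      rw [hX, ← Matrix.mulVec_mulVec, ← Matrix.mulVec_mulVec, hPφ φ, hPφ, dotProduct]
      refine Finset.sum_congr rfl fun p _ => ?_
      simp only [hψ, Pi.star_apply, star_mul']
      split_ifs
      · simp only [one_mul, star_one]
        ring
      · simp
    have hψφ : ∑ p, ‖ψ p‖ ^ 2 ≤ ∑ p, ‖φ p‖ ^ 2 := by
      refine Finset.sum_le_sum fun p _ => ?_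
      simp only [hψ]
      split_ifs
      · rw [one_mul]
      · rw [zero_mul, norm_zero, zero_pow two_ne_zero]
        positivity
    have hvnorm : ‖v‖ ^ 2 = ∑ p, ‖φ p‖ ^ 2 := EuclideanSpace.norm_sq_eq v
    rw [hinner]
    by_cases hpos : 0 < ∑ p, ‖ψ p‖ ^ 2
    · have hsupp : ∀ p, ψ p ≠ 0 → ∃ w ∈ box 4 n, p.1 = q.1 + Torus.proj L w := by
        intro p hp
        by_contra hno
        apply hp
        simp only [hψ]
        rw [if_neg (by exact hno), zero_mul]
      calc ‖∑ p, star (ψ p) * (K *ᵥ ψ) p‖ ≤ 4 * (1 - θ) * ∑ p, ‖ψ p‖ ^ 2 := (hnf ψ hsupp hpos).le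
        _ ≤ 4 * (1 - θ) * ∑ p, ‖φ p‖ ^ 2 := mul_le_mul_of_nonneg_left hψφ hc
        _ = 4 * (1 - θ) * ‖v‖ ^ 2 := by rw [hvnorm]
    · have hzero : ∑ p, ‖ψ p‖ ^ 2 = 0 :=
        le_antisymm (not_lt.1 hpos) (Finset.sum_nonneg fun p _ => by positivity)
      have hψ0 : ∀ p, ψ p = 0 := fun p => by
        have := (Finset.sum_eq_zero_iff_of_nonneg fun p _ => by positivity).1 hzero p (Finset.mem_univ _)
        simpa using this
      have h0 : ∑ p, star (ψ p) * (K *ᵥ ψ) p = 0 :=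
        Finset.sum_eq_zero fun p _ => by rw [hψ0 p, star_zero, zero_mul]
      rw [h0, norm_zero]
      positivity
  -- Berger–Pearcy for the column `e_q`
  have hBP := Literature.Analysis.InnerProduct.matrix_norm_pow_mulVec_le_two_mul_numericalRadius_pow X hc
    hnr n (EuclideanSpace.single q 1)
  rw [PiLp.norm_single, norm_one, mul_one] at hBP
  have hsq : ∑ p, ‖(K ^ n *ᵥ Pi.single q 1) p‖ ^ 2 =
      ‖Matrix.toEuclideanLin (X ^ n) (EuclideanSpace.single q (1 : ℂ))‖ ^ 2 := by
    rw [EuclideanSpace.norm_sq_eq, heq]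
    rfl
  rw [hsq]
  calc ‖Matrix.toEuclideanLin (X ^ n) (EuclideanSpace.single q (1 : ℂ))‖ ^ 2 ≤ (2 * (4 * (1 - θ)) ^ n) ^ 2 :=
        pow_le_pow_left₀ (norm_nonneg _) hBP 2
    _ = 4 * (4 * (1 - θ)) ^ (2 * n) := by ring

end ColumnBounds

/-! ## The pathwise column bound -/

/-- **Pathwise column bound.**  Given the deterministic pricing DET of `θ`-flat fermion fields supported in
the ball `x + proj(box n)` (a flat field forces a dense grid-resonant box of sides in `[ℓ, 2ℓ)` with corner
near `x` and grid index `|k| ≤ π/√(512θ) + 1 ≤ K_f`), every column of `K_Uⁿ` obeys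
`‖K_Uⁿ e_q‖² ≤ 4 (4(1−θ))^{2n} + 16ⁿ · Σ_{(k,a,m)} 1[box event (k,a,m) holds at U]`, the sum ranging over
the finite index set of grid indices, corners and side lengths. -/
theorem cornerAsm_col_le (L : ℕ) [NeZero L] (U : GaugeConfig 4 L SU3) {θ : ℝ} (hθ : θ ≤ 1) {n : ℕ}
    (hn : 1 ≤ n) (ℓ Kf : ℕ) (hKf : Real.pi / Real.sqrt (512 * θ) + 1 < Kf + 1) (q : QuarkIdx L)
    (hDET : ∀ ψ : QuarkIdx L → ℂ, (∀ p, ψ p ≠ 0 → ∃ v ∈ box 4 n, p.1 = q.1 + Torus.proj L v) →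
      0 < ∑ p, ‖ψ p‖ ^ 2 →
      4 * (1 - θ) * (∑ p, ‖ψ p‖ ^ 2) ≤
        ‖∑ p, star (ψ p) * ((∑ μ, wilsonHop (fundamentalRep (Fin 3)) U μ) *ᵥ ψ) p‖ →
      ∃ k : ℤ, (|k| : ℝ) ≤ Real.pi / Real.sqrt (512 * θ) + 1 ∧
      ∃ a : Fin 4 → ℤ, (∀ i, ((q.1 i).val : ℤ) - n - 2 * ℓ ≤ a i ∧ a i ≤ ((q.1 i).val : ℤ) + n + 1) ∧
      ∃ m : Fin 4 → ℕ, (∀ i, ℓ ≤ m i ∧ m i < 2 * ℓ) ∧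
      (∏ i, m i) ≤ 16 * ((Fintype.piFinset fun i => Finset.Ico (a i) (a i + m i)).filter
        (fun v => 1 ≤ Multiset.countP
          (fun w : ℂ => ‖w - Complex.exp (↑((k : ℝ) * Real.sqrt (512 * θ)) * Complex.I)‖ ≤
            Real.sqrt (2048 * θ))
          (fundamentalRep (Fin 3) (plaquetteHolonomy U (Torus.proj L v) 0 1)).charpoly.roots)).card) :
    ∑ p, ‖((∑ μ, wilsonHop (fundamentalRep (Fin 3)) U μ) ^ n *ᵥ Pi.single q 1) p‖ ^ 2 ≤
      4 * (4 * (1 - θ)) ^ (2 * n) + 16 ^ n *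
        ∑ t ∈ Finset.Icc (-(Kf : ℤ)) Kf ×ˢ
            ((Fintype.piFinset fun i : Fin 4 =>
                Finset.Icc (((q.1 i).val : ℤ) - n - 2 * ℓ) (((q.1 i).val : ℤ) + n + 1)) ×ˢ
              (Fintype.piFinset fun _ : Fin 4 => Finset.Ico ℓ (2 * ℓ))),
          (if (∏ i, t.2.2 i) ≤ 16 * ((Fintype.piFinset fun i => Finset.Ico (t.2.1 i) (t.2.1 i + t.2.2 i)).filter
              (fun v => 1 ≤ Multiset.countP
                (fun w : ℂ => ‖w - Complex.exp (↑((t.1 : ℝ) * Real.sqrt (512 * θ)) * Complex.I)‖ ≤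
                  Real.sqrt (2048 * θ))
                (fundamentalRep (Fin 3) (plaquetteHolonomy U (Torus.proj L v) 0 1)).charpoly.roots)).card
            then (1 : ℝ) else 0) := by
  set I : Finset (ℤ × (Fin 4 → ℤ) × (Fin 4 → ℕ)) := Finset.Icc (-(Kf : ℤ)) Kf ×ˢ
    ((Fintype.piFinset fun i : Fin 4 =>
        Finset.Icc (((q.1 i).val : ℤ) - n - 2 * ℓ) (((q.1 i).val : ℤ) + n + 1)) ×ˢ
      (Fintype.piFinset fun _ : Fin 4 => Finset.Ico ℓ (2 * ℓ))) with hI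
  set ind : ℤ × (Fin 4 → ℤ) × (Fin 4 → ℕ) → ℝ := fun t =>
    if (∏ i, t.2.2 i) ≤ 16 * ((Fintype.piFinset fun i => Finset.Ico (t.2.1 i) (t.2.1 i + t.2.2 i)).filter
        (fun v => 1 ≤ Multiset.countP
          (fun w : ℂ => ‖w - Complex.exp (↑((t.1 : ℝ) * Real.sqrt (512 * θ)) * Complex.I)‖ ≤
            Real.sqrt (2048 * θ))
          (fundamentalRep (Fin 3) (plaquetteHolonomy U (Torus.proj L v) 0 1)).charpoly.roots)).card
      then (1 : ℝ) else 0 with hind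
  have hc : 0 ≤ 4 * (1 - θ) := by linarith
  have hind0 : ∀ t, 0 ≤ ind t := fun t => by
    simp only [hind]
    split_ifs <;> norm_num
  have hsum0 : 0 ≤ ∑ t ∈ I, ind t := Finset.sum_nonneg fun t _ => hind0 t
  have hmain0 : 0 ≤ 4 * (4 * (1 - θ)) ^ (2 * n) := mul_nonneg (by norm_num) (pow_nonneg hc _)
  by_cases hflat : ∃ ψ : QuarkIdx L → ℂ, (∀ p, ψ p ≠ 0 → ∃ v ∈ box 4 n, p.1 = q.1 + Torus.proj L v) ∧
      0 < ∑ p, ‖ψ p‖ ^ 2 ∧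
      4 * (1 - θ) * (∑ p, ‖ψ p‖ ^ 2) ≤
        ‖∑ p, star (ψ p) * ((∑ μ, wilsonHop (fundamentalRep (Fin 3)) U μ) *ᵥ ψ) p‖
  · obtain ⟨ψ, hsupp, hpos, hfl⟩ := hflat
    obtain ⟨k, hk, a, ha, m, hm, hE⟩ := hDET ψ hsupp hpos hfl
    have hmem : (k, a, m) ∈ I := by
      simp only [hI, Finset.mem_product, Finset.mem_Icc, Fintype.mem_piFinset, Finset.mem_Ico]
      refine ⟨?_, fun i => ha i, fun i => hm i⟩
      have h1 : (|k| : ℝ) < (Kf : ℝ) + 1 := hk.trans_lt hKf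
      have h2 : |k| < (Kf : ℤ) + 1 := by exact_mod_cast h1
      have h3 := abs_le.1 (Int.lt_add_one_iff.1 h2)
      exact ⟨h3.1, h3.2⟩
    have hone : (1 : ℝ) ≤ ∑ t ∈ I, ind t := by
      refine le_trans (le_of_eq ?_) (Finset.single_le_sum (fun t _ => hind0 t) hmem)
      simp only [hind]
      rw [if_pos hE]
    calc ∑ p, ‖((∑ μ, wilsonHop (fundamentalRep (Fin 3)) U μ) ^ n *ᵥ Pi.single q 1) p‖ ^ 2
        ≤ 16 ^ n := cornerAsm_col_le_sixteen_pow L U hn q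
      _ ≤ 16 ^ n * ∑ t ∈ I, ind t := le_mul_of_one_le_right (by positivity) hone
      _ ≤ 4 * (4 * (1 - θ)) ^ (2 * n) + 16 ^ n * ∑ t ∈ I, ind t := le_add_of_nonneg_left hmain0
  · push Not at hflat
    calc ∑ p, ‖((∑ μ, wilsonHop (fundamentalRep (Fin 3)) U μ) ^ n *ᵥ Pi.single q 1) p‖ ^ 2
        ≤ 4 * (4 * (1 - θ)) ^ (2 * n) := cornerAsm_col_le_of_not_flat L U hθ n q hflat
      _ ≤ 4 * (4 * (1 - θ)) ^ (2 * n) + 16 ^ n * ∑ t ∈ I, ind t :=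
          le_add_of_nonneg_right (mul_nonneg (by positivity) hsum0)


end Summit.QuantumFields.QCD.Cruxes.WindowExtinction.CornerDecorrelationDeepHole

end
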